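import Mathlib

/-!
# InjELeakLaw — the (INJ_E) LEAK LAW: where the hsemireg census is conditional on (INJ_E), and where it is not
(plan-lens-HodgeAV-negation, LINE 15, generation g14; negation lens on H2 = `stmt-HodgeConjecture-18881`; rev 1.1 — §5 added after the
critic's PASS-WITH-PRICE, idea-crit-6 g14 bus l.9562: prices p2 (blocks 3/4 typed, `NoLiveLeak` = all blocks, the GAP LAW) and p3 (`LiftFree` / (LIFT)))

TOKEN `line stmt-HodgeConjecture-18881 Cruxes/BlochSeedDiscOne/Lines/birth.lean 814a6a70c14e831a stub_rung_pad4_seedAt`.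

EVIDENCE-CLASS ARITHMETIC ONLY.  This file proves nothing toward `stub_rung_pad4_seedAt`, 18881 (`BlochSeedDiscOne`), H2,
HC_AV, HC_CM or HC; HC_CM is a displayed binder of the ladder only and the research route is CONDITIONAL on it, not a corollary.
It is the Mathlib-only, kernel-decidable shadow of the card `Ideas/inj-e-leak-law.md`; the homological algebra behind the
dictionary below is PENCIL (card §Lever, to be PEN-audited by the critic), exactly as for the cell's own first-order model.

## The hinge (tree objects, cited by name, NOT imported)
The census no-go `Summit.Ventures.HSemireg.TwoLevelObstruction.not_isBlochSemiregular_of_classY`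
(`Summits/Ventures/HSemireg/TwoLevelObstructionSemiregularityHook.lean`, s4-prove-1 g29) turns «no H₁-static first-order
design» into «no Bloch-semiregular zero locus» through the structure `SemiregularityDictionary`, whose ONE non-classical field is
`injE : ∀ κ, ρ (obExt (hκ κ) h E) = 0 → obExt (hκ κ) h E = 0` — (INJ_E), «NOT classical, NOT proved» (its docstring).  Every UNSAT row of
the census (◇₈-G₁ r1–r3 kit j305149; DIAGUNIT j310554; PCEILING j312296; LINE 4 j310053; ◇₁₀ undecided j308425) therefore
certifies «no seed-carrier» only among designs on which (INJ_E) holds.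

## The leak dictionary (pencil; card §Lever)
For a two-level ⊕-block design `0 → 𝓟 → 𝓝 → E → 0` (`𝓝 = ⊕ N_Y`, `𝓟 = ⊕ P_W`, ⊠-line bundles on `P = (E×E)⁴` typed by balanced
letters) with a regular section `s` lifted from `𝓝` and `Z = Z(s)`:  `ker ρ = im (δ : ℍ¹(𝒬) → H²(End E))`,
`𝒬 = [E⊗Λ⁴E^∨ → E⊗Λ³E^∨ → E⊗Λ²E^∨]` (Koszul), and `δ` vanishes on internal word-degree `b ≥ 2`, so `δ` factors through the
words `L = X − ΣA − ΣB` with `A` a multiset of lower cells, `B` at most one upper cell, `m = |A| + |B| ∈ {2,3,4}`, contributing to `ℍ¹`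
through `H^q(P, L)`, `q = |A| + [X upper]`.  By Mumford's index theorem (+ the degenerate cases) and Künneth, `H^q(P, L) ≠ 0` for SOME
line bundle of Hermitian class `L` iff `q ∈ [idxLo L, idxHi L]` — the predicate `Live q L` below.  Hence the decidable support predicate
`NoLiveLeak` implies `ℍ¹(𝒬_{≤1}) = 0`, `δ = 0`, `ρ` injective: (INJ_E) HOLDS OUTRIGHT on such supports, and the census verdict there is
unconditional MOD THE CLASSICAL DICTIONARY (the hook's fields `bloch_hodge`, `pairing_nondeg`, `lemmaZE` + the classical (L2) `ker ρ = im δ`, (L4) factorisation,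
(L5) E₁-vanishing — pencil ×1 each) and given (LIFT) `s ∈ im(H⁰(𝓝) → H⁰(E))` (automatic on `LiftFree` supports, §5).  Its complement — supports with a live word — is the LEAK ROOM: the only place a
seed-carrier can hide from the census.  The diagonal live words are `−Y` for lower cells `Y` of Hermitian rank ≤ 2 (`live_two_neg_iff`),
and their `δ`-images are THEOREM P's partner planes with VIRTUAL partner `D = Y` for every constituent of both levels (card).

## Contents (all `decide`/elementary; no `sorry`, no new axioms)
§1 letters/cells, Hermitian rank, index range, `Live`; §2 the diagonal-leak lemma `live_two_neg_iff` (psd cell `Y`: `Live 2 (−Y) ↔ hrank Y ≤ 2`,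
general proof) and `not_live_neg_of_fc` (a fully charged lower cell is never a diagonal leak cell); §3 supports, `DiagLeak`, `NoLiveLeak₂`,
`diagLeak_not_noLiveLeak₂`, the EQUATOR LAW `noLiveLeak₂_of_aboveEquator` (supports strictly above the equator `2α > h` are block-2 leak-free), `NoLiveLeak₂.mono`, `not_live_of_negDef`; §4 kernel instances on census data: the rank-1 orbit `N[O|O|O|4ℓ_u]` of the j305149 r1 `minus-A2Im` witnesses is a
diagonal leak orbit; a 16-cell G₁-orbit of the ◇₈ ceiling design `c8` (`Pad4TowerLineDesignCert8Data.l8N`) plus the certified cell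
`P[6I+ℓ₋₁]⁴` has no live block-2 word: by the equator law (`c8Fragment_noLiveLeak₂`) and, for F3/F4, also by enumeration (`c8Fragment_noLive_F3F4`); the full design is in the tool log `leak-c8.log` (0 live words, m = 2,3,4).
Full numbers (tool `leakwords.py` 175fd619e01d1590): LINE-12 design 1beef026 (304 N ∕ 464 P): 0 live words (m = 2,3,4; log 140ec577e6638f6e);
c8 (80 N ∕ 140 P): 0 (7fa9f5b673df0792); j305149 r1 witnesses `core_only` ∕ `odd_fc` ∕ `full` minus-A2Im (floor-hung; 1227∕465, 687∕289, 677∕371 cells): 305 ∕ 233 ∕ 241 diagonal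
leak cells and > 2 000 live words in each of F1–F4 (logs 2be2a48d6d3338ea, 394d8d495aacf0bd, 99243849c6e52efa); the display programme's supports of
record c4c48e1e (RB16, 33∕32), a1a8405d (17∕48), bd78f9c7 (513∕880): 0 live words, m = 2,3,4 (logs 9e56656ba6ed88be, 6dfc89c079bdea28, b29cf9e1d488e45f).
§5 (rev 1.1): `word₃`/`word₄`, `NoLiveLeak₃`/`NoLiveLeak₄`, `NoLiveLeak` (all blocks, THE hypothesis of LAW (i)) + `.mono`; the GAP LAW (`Letter.negDef_sub₂₃₄`,
`Support.noLiveLeak₂₃₄_of_gap`: `top x < Σ gap y_i` per factor ⇒ negative definite ⇒ index `{8}`); `LiftFree`, `liftFree_of_gap`, `equatorCell_live` (c8 is not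
lift-free); ALL-BLOCK kernel certificates `c8Fragment_noLiveLeak` (equator + gap law) and `suppA1a8_noLiveLeak` + `suppA1a8_liftFree` for the display support of record
`a1a8405d` typed literally (65 cells; gap law alone, no enumeration); `toyFloor_leaks₃`.
-/

set_option linter.dupNamespace false
set_option linter.style.longLine false

namespace Summit.HodgeConjecture.HodgeConjecture.Cruxes.BlochSeedDiscOne.InjELeakLaw

/-! ## §1 Letters, cells, Hermitian rank, index range -/

/-- A balanced letter `(α, Re β, Im β)`: the Hermitian block `[[α, β], [β̄, α]]` of a line-bundle class on one factor `E × E`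
(`α = t + c`, `β = c·ζ` for the census letter `tI + cℓ_ζ`). -/
abbrev Letter := ℤ × ℤ × ℤ

/-- A cell = one ⊠-line-bundle constituent: a letter on each of the four factors. -/
abbrev Cell := Fin 4 → Letter

namespace Letter

/-- `α`. -/
def a (x : Letter) : ℤ := x.1
/-- `|β|²`. -/
def s (x : Letter) : ℤ := x.2.1 * x.2.1 + x.2.2 * x.2.2

/-- negation (dual class). -/
def neg (x : Letter) : Letter := (-x.1, -x.2.1, -x.2.2)
/-- difference of classes. -/
def sub (x y : Letter) : Letter := (x.1 - y.1, x.2.1 - y.2.1, x.2.2 - y.2.2)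

/-- positive semidefinite block: `α ≥ 0` and `α² ≥ |β|²` (the effective letters of the census are psd). -/
def Psd (x : Letter) : Prop := 0 ≤ x.a ∧ x.s ≤ x.a * x.a

instance (x : Letter) : Decidable x.Psd := by unfold Psd; infer_instance

/-- Hermitian rank of the block `[[α, β], [β̄, α]]`: `0` for the zero letter, `1` if `α² = |β|² ≠ 0`, else `2`. -/
def hrank (x : Letter) : ℕ :=
  if x.1 = 0 ∧ x.2.1 = 0 ∧ x.2.2 = 0 then 0 else if x.a * x.a = x.s then 1 else 2

/-- fully charged on this factor: `β ≠ 0`. -/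
def Charged (x : Letter) : Prop := ¬ (x.2.1 = 0 ∧ x.2.2 = 0)

instance (x : Letter) : Decidable x.Charged := by unfold Charged; infer_instance

/-- Lower end of the INDEX RANGE of the class on one factor `E × E` (eigenvalues `α ± |β|`): the least `i` with `H^i(E×E, L) ≠ 0`
for some line bundle `L` of this class.  Non-degenerate (Mumford §16): `{0}`, `{1}`, `{2}` by the number of negative eigenvalues;
degenerate: zero class `[0,2]`; null of rank one with `α > 0`: `[0,1]`; with `α < 0`: `[1,2]`. -/
def idxLo (x : Letter) : ℕ :=
  if x.s < x.a * x.a then (if 0 < x.a then 0 else 2)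
  else if x.a * x.a < x.s then 1
  else if 0 < x.a then 0 else if x.a < 0 then 1 else 0

/-- Upper end of the index range (see `idxLo`). -/
def idxHi (x : Letter) : ℕ :=
  if x.s < x.a * x.a then (if 0 < x.a then 0 else 2)
  else if x.a * x.a < x.s then 1
  else if 0 < x.a then 1 else if x.a < 0 then 2 else 2

theorem idxLo_le_idxHi (x : Letter) : x.idxLo ≤ x.idxHi := by
  unfold idxLo idxHi; split_ifs <;> omega

theorem idxHi_le_two (x : Letter) : x.idxHi ≤ 2 := by
  unfold idxHi; split_ifs <;> omega

end Letter

namespace Cell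

/-- pointwise negation / difference of cells (classes of `L^∨`, `L ⊗ M^∨`). -/
def neg (X : Cell) : Cell := fun f => (X f).neg
/-- see `neg`. -/
def sub (X Y : Cell) : Cell := fun f => (X f).sub (Y f)

/-- Hermitian rank of the cell = sum over the four factors (the `R`-rank of `−Y` in THEOREM P's language is `8 − hrank`... of the
positive part; here: rank of the psd form). -/
def hrank (X : Cell) : ℕ := (X 0).hrank + (X 1).hrank + (X 2).hrank + (X 3).hrank

/-- psd cell: every letter psd. -/
def Psd (X : Cell) : Prop := (X 0).Psd ∧ (X 1).Psd ∧ (X 2).Psd ∧ (X 3).Psd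

instance (X : Cell) : Decidable X.Psd := by unfold Psd; infer_instance

/-- fully charged cell (an `FC` cell of the census): charged on all four factors. -/
def FC (X : Cell) : Prop := (X 0).Charged ∧ (X 1).Charged ∧ (X 2).Charged ∧ (X 3).Charged

instance (X : Cell) : Decidable X.FC := by unfold FC; infer_instance

/-- Künneth: the index range of a ⊠-product is the sumset of the factor ranges. -/
def idxLo (X : Cell) : ℕ := (X 0).idxLo + (X 1).idxLo + (X 2).idxLo + (X 3).idxLo
/-- see `idxLo`. -/
def idxHi (X : Cell) : ℕ := (X 0).idxHi + (X 1).idxHi + (X 2).idxHi + (X 3).idxHi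

/-- `Live q L`: `H^q(P, L) ≠ 0` for SOME line bundle of Hermitian class `L` on `P = (E×E)⁴` (index theorem + degenerate cases + Künneth):
`q` lies in the index range.  A word of the leak complex is LIVE when its cohomological degree is. -/
def Live (q : ℕ) (L : Cell) : Prop := L.idxLo ≤ q ∧ q ≤ L.idxHi

instance (q : ℕ) (L : Cell) : Decidable (Live q L) := by unfold Live; infer_instance

theorem idxHi_le_eight (X : Cell) : X.idxHi ≤ 8 := by
  have h0 := (X 0).idxHi_le_two; have h1 := (X 1).idxHi_le_two
  have h2 := (X 2).idxHi_le_two; have h3 := (X 3).idxHi_le_two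
  unfold idxHi; omega

end Cell

/-! ## §2 The diagonal-leak lemma: `Live 2 (−Y) ↔ hrank Y ≤ 2` for psd `Y`; FC cells never leak diagonally -/

namespace Letter

/-- Serre-duality shadow on one factor, psd case: the index range of `−x` is `[hrank x, 2]`. -/
theorem idx_neg_of_psd (x : Letter) (hx : x.Psd) : x.neg.idxLo = x.hrank ∧ x.neg.idxHi = 2 := by
  obtain ⟨a, re, im⟩ := x
  simp only [Psd, Letter.a, Letter.s] at hx
  obtain ⟨ha, hs⟩ := hx
  have hre : 0 ≤ re * re := mul_self_nonneg re
  have him : 0 ≤ im * im := mul_self_nonneg im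
  simp only [neg, idxLo, idxHi, hrank, Letter.a, Letter.s, neg_mul_neg, neg_pos, neg_lt_zero]
  by_cases h0 : a = 0
  · subst h0
    have hre0 : re = 0 := by nlinarith
    have him0 : im = 0 := by nlinarith
    subst hre0; subst him0
    simp
  · have hapos : 0 < a := lt_of_le_of_ne ha (Ne.symm h0)
    have hnot : ¬ a < 0 := not_lt.mpr ha
    by_cases h1 : a * a = re * re + im * im
    · have : ¬ (re * re + im * im < a * a) := by rw [h1]; exact lt_irrefl _
      have : ¬ (a * a < re * re + im * im) := by rw [h1]; exact lt_irrefl _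
      simp [*]
    · have hlt : re * re + im * im < a * a := lt_of_le_of_ne hs (Ne.symm h1)
      have : ¬ (a * a < re * re + im * im) := not_lt.mpr hs
      simp [h0, h1, hlt, hnot]

end Letter

namespace Cell

/-- THE DIAGONAL-LEAK LEMMA.  For a psd lower cell `Y`, the diagonal block-2 word `X − X − Y = −Y` (any constituent `X`) is live in
its degree `q = 2` iff the Hermitian rank of `Y` is at most `2` — i.e. `H²(P, −Y) ≠ 0` exactly for the zero cell, the rank-1 cells
(one null letter `cℓ_ζ`, pulled back from an elliptic curve) and the rank-2 cells.  More generally the index range of `−Y` is `[hrank Y, 8]`. -/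
theorem idx_neg_of_psd (Y : Cell) (hY : Y.Psd) : Y.neg.idxLo = Y.hrank ∧ Y.neg.idxHi = 8 := by
  obtain ⟨h0, h1, h2, h3⟩ := hY
  obtain ⟨l0, u0⟩ := (Y 0).idx_neg_of_psd h0
  obtain ⟨l1, u1⟩ := (Y 1).idx_neg_of_psd h1
  obtain ⟨l2, u2⟩ := (Y 2).idx_neg_of_psd h2
  obtain ⟨l3, u3⟩ := (Y 3).idx_neg_of_psd h3
  simp only [idxLo, idxHi, hrank, neg] at *
  omega

/-- `live_neg_iff`: for psd `Y` and `q ≤ 8`, `Live q (−Y) ↔ hrank Y ≤ q`. -/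
theorem live_neg_iff (Y : Cell) (hY : Y.Psd) (q : ℕ) (hq : q ≤ 8) : Live q Y.neg ↔ Y.hrank ≤ q := by
  obtain ⟨hl, hu⟩ := Y.idx_neg_of_psd hY
  unfold Live; rw [hl, hu]; omega

/-- the case used by the census placement: diagonal leak cells are exactly the lower cells of Hermitian rank ≤ 2. -/
theorem live_two_neg_iff (Y : Cell) (hY : Y.Psd) : Live 2 Y.neg ↔ Y.hrank ≤ 2 :=
  Y.live_neg_iff hY 2 (by norm_num)

/-- a charged letter has Hermitian rank ≥ 1. -/
theorem _root_.Summit.HodgeConjecture.HodgeConjecture.Cruxes.BlochSeedDiscOne.InjELeakLaw.Letter.one_le_hrank_of_charged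
    (x : Letter) (hx : x.Charged) : 1 ≤ x.hrank := by
  unfold Letter.hrank; unfold Letter.Charged at hx
  split_ifs with h h'
  · exact absurd ⟨h.2.1, h.2.2⟩ hx
  · exact le_refl 1
  · norm_num

/-- an FC cell has Hermitian rank ≥ 4 … -/
theorem four_le_hrank_of_fc (Y : Cell) (hY : Y.FC) : 4 ≤ Y.hrank := by
  obtain ⟨c0, c1, c2, c3⟩ := hY
  have := (Y 0).one_le_hrank_of_charged c0; have := (Y 1).one_le_hrank_of_charged c1
  have := (Y 2).one_le_hrank_of_charged c2; have := (Y 3).one_le_hrank_of_charged c3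
  unfold hrank; omega

/-- … hence an FC lower cell is NEVER a diagonal leak cell (degrees 2 and 3): the FC core of the census is leak-inert on the diagonal. -/
theorem not_live_neg_of_fc (Y : Cell) (hY : Y.Psd) (hfc : Y.FC) (q : ℕ) (hq : q ≤ 3) : ¬ Live q Y.neg := by
  rw [Y.live_neg_iff hY q (by omega)]
  have := Y.four_le_hrank_of_fc hfc
  omega

/-- negative definite on every factor ⇒ index range `{8}` ⇒ never live in the leak degrees `q ≤ 7`.  This is WHY ceiling-anchored designs are
leak-free (all words `X − Y − Y'` are dominated by `−Y − Y'`, tall) and why the twisted regime `E(t)`, `t ≫ 0`, of the c4-1 cell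
(`C4-KOSZUL-COMPAT`: exact defect, `ρ` injective) has no leak room: twisting shifts every block-`m` word by `−(m−1)t·I⁴`. -/
theorem not_live_of_negDef (L : Cell) (h : ∀ f, (L f).s < (L f).a * (L f).a ∧ (L f).a < 0) (q : ℕ) (hq : q ≤ 7) : ¬ Live q L := by
  have key : ∀ f, (L f).idxLo = 2 := by
    intro f; obtain ⟨hs, ha⟩ := h f
    unfold Letter.idxLo
    rw [if_pos hs, if_neg (not_lt.mpr (le_of_lt ha))]
  unfold Live idxLo; rw [key 0, key 1, key 2, key 3]; omega

end Cell

/-! ## §3 Supports, the block-2 live-word families, `NoLiveLeak₂`, `DiagLeak` -/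

/-- A two-level support: lower cells (`𝓝`-constituents) and upper cells (`𝓟`-constituents), as lists of cells. -/
structure Support where
  lower : List Cell
  upper : List Cell

namespace Support

/-- the block-2 word `X − Y − Y'`. -/
def word₂ (X Y Y' : Cell) : Cell := (X.sub Y).sub Y'

/-- F1: `X` lower, `Y, Y'` lower, degree 2.   F2: `X` lower, `Y` lower, `W` upper, degree 1.
    F3: `X` upper, `Y, Y'` lower, degree 3.   F4: `X` upper, `Y` lower, `W` upper, degree 2.
`NoLiveLeak₂ S`: no live block-2 word with internal degree `b ≤ 1` (the `b = 2` words `X − W − W'` are `δ`-null). -/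
def NoLiveLeak₂ (S : Support) : Prop :=
  (∀ X ∈ S.lower, ∀ Y ∈ S.lower, ∀ Y' ∈ S.lower, ¬ Cell.Live 2 (word₂ X Y Y')) ∧
  (∀ X ∈ S.lower, ∀ Y ∈ S.lower, ∀ W ∈ S.upper, ¬ Cell.Live 1 (word₂ X Y W)) ∧
  (∀ X ∈ S.upper, ∀ Y ∈ S.lower, ∀ Y' ∈ S.lower, ¬ Cell.Live 3 (word₂ X Y Y')) ∧
  (∀ X ∈ S.upper, ∀ Y ∈ S.lower, ∀ W ∈ S.upper, ¬ Cell.Live 2 (word₂ X Y W))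

instance (S : Support) : Decidable S.NoLiveLeak₂ := by unfold NoLiveLeak₂; infer_instance

/-- `DiagLeak S`: some lower cell has Hermitian rank ≤ 2 (a diagonal leak cell: `H²(P, −Y) ≠ 0` is possible). -/
def DiagLeak (S : Support) : Prop := ∃ Y ∈ S.lower, Y.hrank ≤ 2

instance (S : Support) : Decidable S.DiagLeak := by unfold DiagLeak; infer_instance

theorem word₂_self (X Y : Cell) : word₂ X X Y = Y.neg := by
  funext f
  simp only [word₂, Cell.sub, Cell.neg, Letter.sub, Letter.neg, sub_self, zero_sub]

/-- A diagonal leak cell in a psd support produces a live F1 word (`X − X − Y = −Y`, any lower `X`, e.g. `X = Y`):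
`DiagLeak S → ¬ NoLiveLeak₂ S`.  (Contrapositive: a leak-free support has no lower cell of Hermitian rank ≤ 2 — in particular it is
not floor-hung through rank-1 cells and contains no zero cell.) -/
theorem diagLeak_not_noLiveLeak₂ (S : Support) (hpsd : ∀ Y ∈ S.lower, Y.Psd) (h : S.DiagLeak) : ¬ S.NoLiveLeak₂ := by
  obtain ⟨Y, hY, hr⟩ := h
  intro hno
  have h1 := hno.1 Y hY Y hY Y hY
  rw [word₂_self, Cell.live_two_neg_iff Y (hpsd Y hY)] at h1
  exact h1 hr

/-- THE EQUATOR LAW (block 2).  If every letter of every cell of the support (both levels, every factor) lies STRICTLY ABOVE THE EQUATOR of the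
diamond `◇_h` — `2α > h` — and below the roof — `α ≤ h` —, then no block-2 word is live: on every factor the difference letter `x − y − y'` has
`α < 0`, hence `idxLo ≥ 1`, so every word has `idxLo ≥ 4 > q` for the block-2 degrees `q ≤ 3`.  (The tall orbits of the ceiling designs are of this kind — e.g. the `c8` fragment of §4 —, but NOT the whole of `c8` ∕ LINE-12: their 16 upper
cells `P[(h∕2)ℓ_ζ | hI | hI | hI]` sit ON the equator, so the full designs need the census (tool logs: 0 live words); the floor-hung world is far below.  Blocks 3, 4 need the census: their degrees reach `q = 4, 5`.) -/
theorem noLiveLeak₂_of_aboveEquator (S : Support) (h : ℤ)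
    (hN : ∀ Y ∈ S.lower, ∀ f, h < 2 * (Y f).a ∧ (Y f).a ≤ h) (hP : ∀ W ∈ S.upper, ∀ f, h < 2 * (W f).a ∧ (W f).a ≤ h) :
    S.NoLiveLeak₂ := by
  -- one factor: α(x − y − y') < 0 ⇒ idxLo ≥ 1
  have letter : ∀ x y y' : Letter, x.a ≤ h → h < 2 * y.a → h < 2 * y'.a → 1 ≤ ((x.sub y).sub y').idxLo := by
    intro x y y' hx hy hy'
    have hneg : ((x.sub y).sub y').a < 0 := by simp only [Letter.sub, Letter.a] at *; omega
    unfold Letter.idxLo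
    split_ifs <;> omega
  -- a word all of whose factors have idxLo ≥ 1 is not live in degrees ≤ 3
  have word : ∀ X Y Y' : Cell, (∀ f, (X f).a ≤ h) → (∀ f, h < 2 * (Y f).a) → (∀ f, h < 2 * (Y' f).a) →
      ∀ q, q ≤ 3 → ¬ Cell.Live q (word₂ X Y Y') := by
    intro X Y Y' hX hY hY' q hq hlive
    have l0 := letter (X 0) (Y 0) (Y' 0) (hX 0) (hY 0) (hY' 0)
    have l1 := letter (X 1) (Y 1) (Y' 1) (hX 1) (hY 1) (hY' 1)
    have l2 := letter (X 2) (Y 2) (Y' 2) (hX 2) (hY 2) (hY' 2)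
    have l3 := letter (X 3) (Y 3) (Y' 3) (hX 3) (hY 3) (hY' 3)
    simp only [Cell.Live, Cell.idxLo, word₂, Cell.sub] at hlive
    omega
  refine ⟨?_, ?_, ?_, ?_⟩
  · intro X hX Y hY Y' hY'
    exact word X Y Y' (fun f => (hN X hX f).2) (fun f => (hN Y hY f).1) (fun f => (hN Y' hY' f).1) 2 (by norm_num)
  · intro X hX Y hY W hW
    exact word X Y W (fun f => (hN X hX f).2) (fun f => (hN Y hY f).1) (fun f => (hP W hW f).1) 1 (by norm_num)
  · intro X hX Y hY Y' hY'
    exact word X Y Y' (fun f => (hP X hX f).2) (fun f => (hN Y hY f).1) (fun f => (hN Y' hY' f).1) 3 (by norm_num)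
  · intro X hX Y hY W hW
    exact word X Y W (fun f => (hP X hX f).2) (fun f => (hN Y hY f).1) (fun f => (hP W hW f).1) 2 (by norm_num)


/-- `NoLiveLeak₂` is inherited by sub-supports: every sub-design of a leak-free support (e.g. of the LINE-12 support 1beef026 or of `c8`,
both certified leak-free by the tool logs) is leak-free, hence (INJ_E)-clean. -/
theorem NoLiveLeak₂.mono {S T : Support} (hl : T.lower ⊆ S.lower) (hu : T.upper ⊆ S.upper) (h : S.NoLiveLeak₂) : T.NoLiveLeak₂ := by
  obtain ⟨h1, h2, h3, h4⟩ := h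
  exact ⟨fun X hX Y hY Y' hY' => h1 X (hl hX) Y (hl hY) Y' (hl hY'),
    fun X hX Y hY W hW => h2 X (hl hX) Y (hl hY) W (hu hW),
    fun X hX Y hY Y' hY' => h3 X (hu hX) Y (hl hY) Y' (hl hY'),
    fun X hX Y hY W hW => h4 X (hu hX) Y (hl hY) W (hu hW)⟩

end Support

/-! ## §4 Kernel instances on census data -/

/-- cell builder (same convention as `Pad4TowerCrossPhase.mcellOf`: letters `(α, Re β, Im β)` on factors 0–3). -/
def cellOf (l0 l1 l2 l3 : Letter) : Cell := ![l0, l1, l2, l3]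

/-- the zero letter `O` and the floor letter `4ℓ_ζ` for the four phases `ζ ∈ {1, i, −1, −i}`. -/
def O : Letter := (0, 0, 0)
/-- see `O`. -/
def fl4 (k : Fin 4) : Letter := ![(4, 4, 0), (4, 0, 4), (4, -4, 0), (4, 0, -4)] k

/-- the rank-1 orbit `N[O|O|O|4ℓ_ζ]` (16 cells: charged factor × phase) present on the LOWER level of the j305149 r1 `minus-A2Im` witnesses
`core_only` and `odd_fc` (`witness-famcore-{core_only,odd_fc}-minus-A2Im-kissat.json`, lower histogram row `hrank 1: 16`; the `full` witness has it on
the upper level and carries the zero cell + 240 rank-2 cells below instead). -/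
def rank1Orbit : List Cell :=
  (List.finRange 4).flatMap fun f => (List.finRange 4).map fun k => Function.update (fun _ => O) f (fl4 k)

theorem rank1Orbit_length : rank1Orbit.length = 16 := by decide

/-- every cell of the orbit is psd of Hermitian rank 1, hence a diagonal leak cell (`live_two_neg_iff`) — kernel check. -/
theorem rank1Orbit_leaks : ∀ Y ∈ rank1Orbit, Y.Psd ∧ Y.hrank = 1 ∧ Cell.Live 2 Y.neg ∧ Cell.Live 3 Y.neg := by decide

/-- the floor-hung toy support `{N[O|O|O|4ℓ₁], N[ℓ₁]⁴ ; P[O|O|O|3ℓ₁]}` (cells of the r1 witness) has live words in all four families: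
F1 `X − X − N[O|O|O|4ℓ₁]`, F2/F4 with `W = P[O|O|O|3ℓ₁]`, F3 with `X = W` — kernel check (`¬ NoLiveLeak₂`). -/
def toyFloor : Support where
  lower := [cellOf O O O (4, 4, 0), cellOf (1, 1, 0) (1, 1, 0) (1, 1, 0) (1, 1, 0)]
  upper := [cellOf O O O (3, 3, 0)]

theorem toyFloor_leaks : ¬ toyFloor.NoLiveLeak₂ := by decide

theorem toyFloor_liveWords :
    Cell.Live 2 (Support.word₂ (cellOf O O O (4,4,0)) (cellOf O O O (4,4,0)) (cellOf O O O (4,4,0))) ∧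
    Cell.Live 1 (Support.word₂ (cellOf (1,1,0) (1,1,0) (1,1,0) (1,1,0)) (cellOf O O O (4,4,0)) (cellOf O O O (3,3,0))) ∧
    Cell.Live 3 (Support.word₂ (cellOf O O O (3,3,0)) (cellOf O O O (4,4,0)) (cellOf O O O (4,4,0))) ∧
    Cell.Live 2 (Support.word₂ (cellOf O O O (3,3,0)) (cellOf O O O (4,4,0)) (cellOf O O O (3,3,0))) := by decide

/-- A 16-cell G₁-orbit of LOWER cells of the ◇₈ ceiling design `c8` (`Pad4TowerLineDesignCert8Data.l8N`: the orbit of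
`N[8I | 8I | 6I+ℓ₋₁ | 4I+2ℓ₁]`, letters `(8,0,0)`, `(8,0,0)`, `(7,-1,0)`, `(6,2,0)` up to `S₄ × Δ`), with the certified upper cell
`P[6I+ℓ₋₁]⁴ = (7,-1,0)⁴` (`Pad4TowerLineDesignCert8.cuCell`). -/
def e8 : Letter := (8, 0, 0)
/-- see `e8`. -/
def u7 (k : Fin 4) : Letter := ![(7, -1, 0), (7, 0, -1), (7, 1, 0), (7, 0, 1)] k
/-- see `e8`. -/
def v6 (k : Fin 4) : Letter := ![(6, 2, 0), (6, 0, 2), (6, -2, 0), (6, 0, -2)] k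

/-- the orbit: positions of the two charged letters (ordered pair of distinct factors) × common phase rotation. -/
def c8Orbit : List Cell :=
  (List.finRange 4).flatMap fun i => (List.finRange 4).flatMap fun j =>
    if i = j then [] else (List.finRange 4).map fun k =>
      Function.update (Function.update (fun _ => e8) i (u7 k)) j (v6 k)

/-- the ceiling fragment: 12 ordered factor pairs × 4 phases = 48 lower cells, and the upper cell `cuCell`. -/
def c8Fragment : Support where
  lower := c8Orbit
  upper := [cellOf (7, -1, 0) (7, -1, 0) (7, -1, 0) (7, -1, 0)]

theorem c8Orbit_length : c8Orbit.length = 48 := by decide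

/-- all 48 lower cells have full Hermitian rank 8 (no diagonal leak cell) — kernel check. -/
theorem c8Fragment_no_diagLeak : ¬ c8Fragment.DiagLeak := by decide

/-- the F3/F4 families of the fragment (upper `X = cuCell`, 48 × 48 resp. 48 × 1 words) have no live word — kernel check
(the F1/F2 families, 48³ resp. 48² words, and the whole design are certified by the tool log `leak-c8.log`: 0 live words). -/
theorem c8Fragment_noLive_F3F4 :
    (∀ X ∈ c8Fragment.upper, ∀ Y ∈ c8Fragment.lower, ∀ Y' ∈ c8Fragment.lower, ¬ Cell.Live 3 (Support.word₂ X Y Y')) ∧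
    (∀ X ∈ c8Fragment.upper, ∀ Y ∈ c8Fragment.lower, ∀ W ∈ c8Fragment.upper, ¬ Cell.Live 2 (Support.word₂ X Y W)) := by
  decide

/-- the fragment lies strictly above the equator of `◇₈` (`8 < 2α`, `α ≤ 8` on every factor, both levels) — kernel check —, so the equator law
certifies ALL FOUR block-2 families at once (including F1/F2, 48³ + 48² words, without enumeration). -/
theorem c8Fragment_aboveEquator :
    (∀ Y ∈ c8Fragment.lower, ∀ f, (8 : ℤ) < 2 * (Y f).a ∧ (Y f).a ≤ 8) ∧ (∀ W ∈ c8Fragment.upper, ∀ f, (8 : ℤ) < 2 * (W f).a ∧ (W f).a ≤ 8) := by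
  constructor <;> decide

theorem c8Fragment_noLiveLeak₂ : c8Fragment.NoLiveLeak₂ :=
  c8Fragment.noLiveLeak₂_of_aboveEquator 8 c8Fragment_aboveEquator.1 c8Fragment_aboveEquator.2

/-! ## §5 (rev 1.1 — critic idea-crit-6 g14, bus l.9562, prices p2/p3) Blocks 3 and 4, `NoLiveLeak` (ALL blocks), the GAP LAW, `LiftFree`,
and two all-block kernel certificates (`c8Fragment`, the display support `a1a8405d`)

LAW (i) needs the words of ALL blocks `m = 2, 3, 4` with internal degree `b ≤ 1` (p2).  The block-`m` words are `X − ΣA − ΣB`,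
`|A| + |B| = m`, `|B| = b ≤ 1`, in degree `q = |A| + [X upper]`; blocks 3 and 4 reach `q = 4, 5`, so the equator law (`α < 0` per factor
⇒ `idxLo ≥ 4`) does NOT kill them by itself.  What does, in closed form, is the GAP LAW: a difference letter `x − y₁ − … − y_k` is NEGATIVE
DEFINITE as soon as `top x < gap y₁ + … + gap y_k` (`gap = α − ‖β‖₁`, `top = α + ‖β‖₁`, `‖β‖₁ = |Re β| + |Im β| ≥ |β|`), and a word negative
definite on every factor has index range `{8}` (`Cell.not_live_of_negDef`).  The full designs `c8` ∕ LINE-12 ∕ RB16 ∕ bd78f9c7 have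
`gap = 0` letters (`(h∕2)ℓ_ζ` in their 16 ∕ 32 equator upper cells), so for them blocks 3, 4 rest on the tool census (logs: 0 live words) ×1;
the fragment and the tall display support `a1a8405d` (h = 14) are certified below in ALL blocks without enumeration. -/

namespace Letter

/-- `‖β‖₁ = |Re β| + |Im β|` (an integer upper bound for `|β|`). -/
def l1 (x : Letter) : ℤ := |x.2.1| + |x.2.2|
/-- `gap x = α − ‖β‖₁`: an integer lower bound for the least eigenvalue `α − |β|`. -/
def gap (x : Letter) : ℤ := x.a - x.l1
/-- `top x = α + ‖β‖₁`: an integer upper bound for the largest eigenvalue `α + |β|`. -/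
def top (x : Letter) : ℤ := x.a + x.l1

theorem l1_nonneg (x : Letter) : 0 ≤ x.l1 := add_nonneg (abs_nonneg _) (abs_nonneg _)

/-- core: `‖β_w‖₁ ≤ M < −α_w` ⇒ `w` negative definite (`|β_w|² < α_w²`, `α_w < 0`). -/
theorem negDef_core (w : Letter) (M : ℤ) (h0 : w.l1 ≤ M) (h1 : M < -w.a) : w.s < w.a * w.a ∧ w.a < 0 := by
  obtain ⟨a, re, im⟩ := w
  simp only [Letter.l1, Letter.a, Letter.s] at *
  have hP := abs_nonneg re
  have hQ := abs_nonneg im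
  have hM : 0 ≤ M := by linarith
  refine ⟨?_, by linarith⟩
  have e1 : |re| * |re| = re * re := abs_mul_abs_self re
  have e2 : |im| * |im| = im * im := abs_mul_abs_self im
  have h2 : (|re| + |im|) * (|re| + |im|) ≤ M * M := mul_self_le_mul_self (by linarith) h0
  have h3 : M * M < (-a) * (-a) := mul_self_lt_mul_self hM h1
  nlinarith

/-- core, positive side: `‖β_x‖₁ < α_x` ⇒ `x` positive definite (`|β_x|² < α_x²`, `0 < α_x`). -/
theorem posDef_core (x : Letter) (h : x.l1 < x.a) : x.s < x.a * x.a ∧ 0 < x.a := by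
  obtain ⟨a, re, im⟩ := x
  simp only [Letter.l1, Letter.a, Letter.s] at *
  have hP := abs_nonneg re
  have hQ := abs_nonneg im
  refine ⟨?_, by linarith⟩
  have e1 : |re| * |re| = re * re := abs_mul_abs_self re
  have e2 : |im| * |im| = im * im := abs_mul_abs_self im
  have h3 : (|re| + |im|) * (|re| + |im|) < a * a := mul_self_lt_mul_self (by linarith) h
  nlinarith

/-- triangle inequalities for the difference letters of blocks 2, 3, 4. -/
theorem l1_sub₂_le (x y₁ y₂ : Letter) : ((x.sub y₁).sub y₂).l1 ≤ x.l1 + y₁.l1 + y₂.l1 := by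
  obtain ⟨a, r, i⟩ := x; obtain ⟨a1, r1, i1⟩ := y₁; obtain ⟨a2, r2, i2⟩ := y₂
  simp only [Letter.l1, Letter.sub]
  have h1 : |r - r1 - r2| ≤ |r| + |r1| + |r2| := by
    rw [abs_le]; constructor <;>
      linarith [le_abs_self r, neg_abs_le r, le_abs_self r1, neg_abs_le r1, le_abs_self r2, neg_abs_le r2]
  have h2 : |i - i1 - i2| ≤ |i| + |i1| + |i2| := by
    rw [abs_le]; constructor <;>
      linarith [le_abs_self i, neg_abs_le i, le_abs_self i1, neg_abs_le i1, le_abs_self i2, neg_abs_le i2]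
  linarith

theorem l1_sub₃_le (x y₁ y₂ y₃ : Letter) : (((x.sub y₁).sub y₂).sub y₃).l1 ≤ x.l1 + y₁.l1 + y₂.l1 + y₃.l1 := by
  obtain ⟨a, r, i⟩ := x; obtain ⟨a1, r1, i1⟩ := y₁; obtain ⟨a2, r2, i2⟩ := y₂; obtain ⟨a3, r3, i3⟩ := y₃
  simp only [Letter.l1, Letter.sub]
  have h1 : |r - r1 - r2 - r3| ≤ |r| + |r1| + |r2| + |r3| := by
    rw [abs_le]; constructor <;>
      linarith [le_abs_self r, neg_abs_le r, le_abs_self r1, neg_abs_le r1, le_abs_self r2, neg_abs_le r2,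
        le_abs_self r3, neg_abs_le r3]
  have h2 : |i - i1 - i2 - i3| ≤ |i| + |i1| + |i2| + |i3| := by
    rw [abs_le]; constructor <;>
      linarith [le_abs_self i, neg_abs_le i, le_abs_self i1, neg_abs_le i1, le_abs_self i2, neg_abs_le i2,
        le_abs_self i3, neg_abs_le i3]
  linarith

theorem l1_sub₄_le (x y₁ y₂ y₃ y₄ : Letter) :
    ((((x.sub y₁).sub y₂).sub y₃).sub y₄).l1 ≤ x.l1 + y₁.l1 + y₂.l1 + y₃.l1 + y₄.l1 := by
  obtain ⟨a, r, i⟩ := x; obtain ⟨a1, r1, i1⟩ := y₁; obtain ⟨a2, r2, i2⟩ := y₂; obtain ⟨a3, r3, i3⟩ := y₃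
  obtain ⟨a4, r4, i4⟩ := y₄
  simp only [Letter.l1, Letter.sub]
  have h1 : |r - r1 - r2 - r3 - r4| ≤ |r| + |r1| + |r2| + |r3| + |r4| := by
    rw [abs_le]; constructor <;>
      linarith [le_abs_self r, neg_abs_le r, le_abs_self r1, neg_abs_le r1, le_abs_self r2, neg_abs_le r2,
        le_abs_self r3, neg_abs_le r3, le_abs_self r4, neg_abs_le r4]
  have h2 : |i - i1 - i2 - i3 - i4| ≤ |i| + |i1| + |i2| + |i3| + |i4| := by
    rw [abs_le]; constructor <;>
      linarith [le_abs_self i, neg_abs_le i, le_abs_self i1, neg_abs_le i1, le_abs_self i2, neg_abs_le i2,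
        le_abs_self i3, neg_abs_le i3, le_abs_self i4, neg_abs_le i4]
  linarith

/-- THE GAP LAW on one factor: `top x < gap y₁ + gap y₂` ⇒ `x − y₁ − y₂` negative definite; same with 3 and 4 subtracted letters. -/
theorem negDef_sub₂ (x y₁ y₂ : Letter) (h : x.top < y₁.gap + y₂.gap) :
    ((x.sub y₁).sub y₂).s < ((x.sub y₁).sub y₂).a * ((x.sub y₁).sub y₂).a ∧ ((x.sub y₁).sub y₂).a < 0 := by
  refine negDef_core _ (x.l1 + y₁.l1 + y₂.l1) (l1_sub₂_le x y₁ y₂) ?_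
  have ha : ((x.sub y₁).sub y₂).a = x.a - y₁.a - y₂.a := by
    obtain ⟨a, r, i⟩ := x; obtain ⟨a1, r1, i1⟩ := y₁; obtain ⟨a2, r2, i2⟩ := y₂; rfl
  rw [ha]; unfold Letter.top Letter.gap at h; linarith

theorem negDef_sub₃ (x y₁ y₂ y₃ : Letter) (h : x.top < y₁.gap + y₂.gap + y₃.gap) :
    (((x.sub y₁).sub y₂).sub y₃).s < (((x.sub y₁).sub y₂).sub y₃).a * (((x.sub y₁).sub y₂).sub y₃).a ∧
      (((x.sub y₁).sub y₂).sub y₃).a < 0 := by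
  refine negDef_core _ (x.l1 + y₁.l1 + y₂.l1 + y₃.l1) (l1_sub₃_le x y₁ y₂ y₃) ?_
  have ha : (((x.sub y₁).sub y₂).sub y₃).a = x.a - y₁.a - y₂.a - y₃.a := by
    obtain ⟨a, r, i⟩ := x; obtain ⟨a1, r1, i1⟩ := y₁; obtain ⟨a2, r2, i2⟩ := y₂; obtain ⟨a3, r3, i3⟩ := y₃; rfl
  rw [ha]; unfold Letter.top Letter.gap at h; linarith

theorem negDef_sub₄ (x y₁ y₂ y₃ y₄ : Letter) (h : x.top < y₁.gap + y₂.gap + y₃.gap + y₄.gap) :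
    ((((x.sub y₁).sub y₂).sub y₃).sub y₄).s < ((((x.sub y₁).sub y₂).sub y₃).sub y₄).a * ((((x.sub y₁).sub y₂).sub y₃).sub y₄).a ∧
      ((((x.sub y₁).sub y₂).sub y₃).sub y₄).a < 0 := by
  refine negDef_core _ (x.l1 + y₁.l1 + y₂.l1 + y₃.l1 + y₄.l1) (l1_sub₄_le x y₁ y₂ y₃ y₄) ?_
  have ha : ((((x.sub y₁).sub y₂).sub y₃).sub y₄).a = x.a - y₁.a - y₂.a - y₃.a - y₄.a := by
    obtain ⟨a, r, i⟩ := x; obtain ⟨a1, r1, i1⟩ := y₁; obtain ⟨a2, r2, i2⟩ := y₂; obtain ⟨a3, r3, i3⟩ := y₃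
    obtain ⟨a4, r4, i4⟩ := y₄; rfl
  rw [ha]; unfold Letter.top Letter.gap at h; linarith

/-- a letter with `gap > 0` is positive definite, hence has index range `{0}`. -/
theorem idx_of_gap_pos (x : Letter) (h : 0 < x.gap) : x.idxLo = 0 ∧ x.idxHi = 0 := by
  have hp := x.posDef_core (by unfold Letter.gap at h; linarith)
  unfold Letter.idxLo Letter.idxHi
  simp [hp.1, hp.2]

end Letter

namespace Support

/-- the block-3 word `X − Y₁ − Y₂ − Y₃` and the block-4 word `X − Y₁ − Y₂ − Y₃ − Y₄` (the last subtracted cell may be an upper cell `W`: `b = 1`). -/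
def word₃ (X Y₁ Y₂ Y₃ : Cell) : Cell := ((X.sub Y₁).sub Y₂).sub Y₃
/-- see `word₃`. -/
def word₄ (X Y₁ Y₂ Y₃ Y₄ : Cell) : Cell := (((X.sub Y₁).sub Y₂).sub Y₃).sub Y₄

/-- `NoLiveLeak₃ S`: no live block-3 word with `b ≤ 1` — families (`b = 0`) `X − Y₁ − Y₂ − Y₃` in degree `3 + [X upper]`, (`b = 1`)
`X − Y₁ − Y₂ − W` in degree `2 + [X upper]`.  Conservative: `Y_i` range over the lower list with repetition, whatever the multiplicities. -/
def NoLiveLeak₃ (S : Support) : Prop :=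
  (∀ X ∈ S.lower, ∀ Y₁ ∈ S.lower, ∀ Y₂ ∈ S.lower, ∀ Y₃ ∈ S.lower, ¬ Cell.Live 3 (word₃ X Y₁ Y₂ Y₃)) ∧
  (∀ X ∈ S.lower, ∀ Y₁ ∈ S.lower, ∀ Y₂ ∈ S.lower, ∀ W ∈ S.upper, ¬ Cell.Live 2 (word₃ X Y₁ Y₂ W)) ∧
  (∀ X ∈ S.upper, ∀ Y₁ ∈ S.lower, ∀ Y₂ ∈ S.lower, ∀ Y₃ ∈ S.lower, ¬ Cell.Live 4 (word₃ X Y₁ Y₂ Y₃)) ∧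
  (∀ X ∈ S.upper, ∀ Y₁ ∈ S.lower, ∀ Y₂ ∈ S.lower, ∀ W ∈ S.upper, ¬ Cell.Live 3 (word₃ X Y₁ Y₂ W))

/-- `NoLiveLeak₄ S`: no live block-4 word with `b ≤ 1` — degrees `4 + [X upper]` (`b = 0`) and `3 + [X upper]` (`b = 1`). -/
def NoLiveLeak₄ (S : Support) : Prop :=
  (∀ X ∈ S.lower, ∀ Y₁ ∈ S.lower, ∀ Y₂ ∈ S.lower, ∀ Y₃ ∈ S.lower, ∀ Y₄ ∈ S.lower, ¬ Cell.Live 4 (word₄ X Y₁ Y₂ Y₃ Y₄)) ∧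
  (∀ X ∈ S.lower, ∀ Y₁ ∈ S.lower, ∀ Y₂ ∈ S.lower, ∀ Y₃ ∈ S.lower, ∀ W ∈ S.upper, ¬ Cell.Live 3 (word₄ X Y₁ Y₂ Y₃ W)) ∧
  (∀ X ∈ S.upper, ∀ Y₁ ∈ S.lower, ∀ Y₂ ∈ S.lower, ∀ Y₃ ∈ S.lower, ∀ Y₄ ∈ S.lower, ¬ Cell.Live 5 (word₄ X Y₁ Y₂ Y₃ Y₄)) ∧
  (∀ X ∈ S.upper, ∀ Y₁ ∈ S.lower, ∀ Y₂ ∈ S.lower, ∀ Y₃ ∈ S.lower, ∀ W ∈ S.upper, ¬ Cell.Live 4 (word₄ X Y₁ Y₂ Y₃ W))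

instance (S : Support) : Decidable S.NoLiveLeak₃ := by unfold NoLiveLeak₃; infer_instance
instance (S : Support) : Decidable S.NoLiveLeak₄ := by unfold NoLiveLeak₄; infer_instance

/-- `NoLiveLeak S` — THE hypothesis of LAW (i): no live word in any block `m = 2, 3, 4` with `b ≤ 1`. -/
def NoLiveLeak (S : Support) : Prop := S.NoLiveLeak₂ ∧ S.NoLiveLeak₃ ∧ S.NoLiveLeak₄

instance (S : Support) : Decidable S.NoLiveLeak := by unfold NoLiveLeak; infer_instance

theorem NoLiveLeak₃.mono {S T : Support} (hl : T.lower ⊆ S.lower) (hu : T.upper ⊆ S.upper) (h : S.NoLiveLeak₃) : T.NoLiveLeak₃ := by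
  obtain ⟨h1, h2, h3, h4⟩ := h
  exact ⟨fun X hX Y₁ a Y₂ b Y₃ c => h1 X (hl hX) Y₁ (hl a) Y₂ (hl b) Y₃ (hl c),
    fun X hX Y₁ a Y₂ b W c => h2 X (hl hX) Y₁ (hl a) Y₂ (hl b) W (hu c),
    fun X hX Y₁ a Y₂ b Y₃ c => h3 X (hu hX) Y₁ (hl a) Y₂ (hl b) Y₃ (hl c),
    fun X hX Y₁ a Y₂ b W c => h4 X (hu hX) Y₁ (hl a) Y₂ (hl b) W (hu c)⟩

theorem NoLiveLeak₄.mono {S T : Support} (hl : T.lower ⊆ S.lower) (hu : T.upper ⊆ S.upper) (h : S.NoLiveLeak₄) : T.NoLiveLeak₄ := by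
  obtain ⟨h1, h2, h3, h4⟩ := h
  exact ⟨fun X hX Y₁ a Y₂ b Y₃ c Y₄ d => h1 X (hl hX) Y₁ (hl a) Y₂ (hl b) Y₃ (hl c) Y₄ (hl d),
    fun X hX Y₁ a Y₂ b Y₃ c W d => h2 X (hl hX) Y₁ (hl a) Y₂ (hl b) Y₃ (hl c) W (hu d),
    fun X hX Y₁ a Y₂ b Y₃ c Y₄ d => h3 X (hu hX) Y₁ (hl a) Y₂ (hl b) Y₃ (hl c) Y₄ (hl d),
    fun X hX Y₁ a Y₂ b Y₃ c W d => h4 X (hu hX) Y₁ (hl a) Y₂ (hl b) Y₃ (hl c) W (hu d)⟩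

/-- `NoLiveLeak` is inherited by sub-supports (every sub-design of a certified support is (INJ_E)-clean, given (LIFT)). -/
theorem NoLiveLeak.mono {S T : Support} (hl : T.lower ⊆ S.lower) (hu : T.upper ⊆ S.upper) (h : S.NoLiveLeak) : T.NoLiveLeak :=
  ⟨h.1.mono hl hu, h.2.1.mono hl hu, h.2.2.mono hl hu⟩

/-- uniform letter bounds of a support: every lower letter has `gap ≥ gN`, every upper letter `gap ≥ gP`, every letter `top ≤ t`. -/
def GapBound (S : Support) (gN gP t : ℤ) : Prop :=
  (∀ Y ∈ S.lower, ∀ f, gN ≤ (Y f).gap ∧ (Y f).top ≤ t) ∧ (∀ W ∈ S.upper, ∀ f, gP ≤ (W f).gap ∧ (W f).top ≤ t)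

instance (S : Support) (gN gP t : ℤ) : Decidable (S.GapBound gN gP t) := by unfold GapBound; infer_instance

/-- THE GAP LAW, block 2: `t < 2 gN` and `t < gN + gP` ⇒ every block-2 word (`b ≤ 1`) is negative definite on every factor ⇒ `NoLiveLeak₂`. -/
theorem noLiveLeak₂_of_gap (S : Support) (gN gP t : ℤ) (hb : S.GapBound gN gP t) (h0 : t < 2 * gN) (h1 : t < gN + gP) :
    S.NoLiveLeak₂ := by
  have word : ∀ X Y₁ Y₂ : Cell, ∀ g₁ g₂ : ℤ, (∀ f, (X f).top ≤ t) → (∀ f, g₁ ≤ (Y₁ f).gap) → (∀ f, g₂ ≤ (Y₂ f).gap) →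
      t < g₁ + g₂ → ∀ q, q ≤ 7 → ¬ Cell.Live q (word₂ X Y₁ Y₂) := by
    intro X Y₁ Y₂ g₁ g₂ hX a b hlt q hq
    refine Cell.not_live_of_negDef _ (fun f => ?_) q hq
    exact Letter.negDef_sub₂ (X f) (Y₁ f) (Y₂ f) (by linarith [hX f, a f, b f])
  obtain ⟨hN, hP⟩ := hb
  refine ⟨?_, ?_, ?_, ?_⟩
  · intro X hX Y₁ a Y₂ b
    exact word X Y₁ Y₂ gN gN (fun f => (hN X hX f).2) (fun f => (hN Y₁ a f).1) (fun f => (hN Y₂ b f).1) (by linarith) 2 (by norm_num)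
  · intro X hX Y₁ a W b
    exact word X Y₁ W gN gP (fun f => (hN X hX f).2) (fun f => (hN Y₁ a f).1) (fun f => (hP W b f).1) (by linarith) 1 (by norm_num)
  · intro X hX Y₁ a Y₂ b
    exact word X Y₁ Y₂ gN gN (fun f => (hP X hX f).2) (fun f => (hN Y₁ a f).1) (fun f => (hN Y₂ b f).1) (by linarith) 3 (by norm_num)
  · intro X hX Y₁ a W b
    exact word X Y₁ W gN gP (fun f => (hP X hX f).2) (fun f => (hN Y₁ a f).1) (fun f => (hP W b f).1) (by linarith) 2 (by norm_num)

/-- THE GAP LAW, block 3: `t < 3 gN` and `t < 2 gN + gP` ⇒ `NoLiveLeak₃`. -/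
theorem noLiveLeak₃_of_gap (S : Support) (gN gP t : ℤ) (hb : S.GapBound gN gP t) (h0 : t < 3 * gN) (h1 : t < 2 * gN + gP) :
    S.NoLiveLeak₃ := by
  have word : ∀ X Y₁ Y₂ Y₃ : Cell, ∀ g₁ g₂ g₃ : ℤ, (∀ f, (X f).top ≤ t) → (∀ f, g₁ ≤ (Y₁ f).gap) → (∀ f, g₂ ≤ (Y₂ f).gap) →
      (∀ f, g₃ ≤ (Y₃ f).gap) → t < g₁ + g₂ + g₃ → ∀ q, q ≤ 7 → ¬ Cell.Live q (word₃ X Y₁ Y₂ Y₃) := by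
    intro X Y₁ Y₂ Y₃ g₁ g₂ g₃ hX a b c hlt q hq
    refine Cell.not_live_of_negDef _ (fun f => ?_) q hq
    exact Letter.negDef_sub₃ (X f) (Y₁ f) (Y₂ f) (Y₃ f) (by linarith [hX f, a f, b f, c f])
  obtain ⟨hN, hP⟩ := hb
  refine ⟨?_, ?_, ?_, ?_⟩
  · intro X hX Y₁ a Y₂ b Y₃ c
    exact word X Y₁ Y₂ Y₃ gN gN gN (fun f => (hN X hX f).2) (fun f => (hN Y₁ a f).1) (fun f => (hN Y₂ b f).1)
      (fun f => (hN Y₃ c f).1) (by linarith) 3 (by norm_num)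
  · intro X hX Y₁ a Y₂ b W c
    exact word X Y₁ Y₂ W gN gN gP (fun f => (hN X hX f).2) (fun f => (hN Y₁ a f).1) (fun f => (hN Y₂ b f).1)
      (fun f => (hP W c f).1) (by linarith) 2 (by norm_num)
  · intro X hX Y₁ a Y₂ b Y₃ c
    exact word X Y₁ Y₂ Y₃ gN gN gN (fun f => (hP X hX f).2) (fun f => (hN Y₁ a f).1) (fun f => (hN Y₂ b f).1)
      (fun f => (hN Y₃ c f).1) (by linarith) 4 (by norm_num)
  · intro X hX Y₁ a Y₂ b W c
    exact word X Y₁ Y₂ W gN gN gP (fun f => (hP X hX f).2) (fun f => (hN Y₁ a f).1) (fun f => (hN Y₂ b f).1)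
      (fun f => (hP W c f).1) (by linarith) 3 (by norm_num)

/-- THE GAP LAW, block 4: `t < 4 gN` and `t < 3 gN + gP` ⇒ `NoLiveLeak₄`. -/
theorem noLiveLeak₄_of_gap (S : Support) (gN gP t : ℤ) (hb : S.GapBound gN gP t) (h0 : t < 4 * gN) (h1 : t < 3 * gN + gP) :
    S.NoLiveLeak₄ := by
  have word : ∀ X Y₁ Y₂ Y₃ Y₄ : Cell, ∀ g₁ g₂ g₃ g₄ : ℤ, (∀ f, (X f).top ≤ t) → (∀ f, g₁ ≤ (Y₁ f).gap) → (∀ f, g₂ ≤ (Y₂ f).gap) →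
      (∀ f, g₃ ≤ (Y₃ f).gap) → (∀ f, g₄ ≤ (Y₄ f).gap) → t < g₁ + g₂ + g₃ + g₄ → ∀ q, q ≤ 7 →
      ¬ Cell.Live q (word₄ X Y₁ Y₂ Y₃ Y₄) := by
    intro X Y₁ Y₂ Y₃ Y₄ g₁ g₂ g₃ g₄ hX a b c d hlt q hq
    refine Cell.not_live_of_negDef _ (fun f => ?_) q hq
    exact Letter.negDef_sub₄ (X f) (Y₁ f) (Y₂ f) (Y₃ f) (Y₄ f) (by linarith [hX f, a f, b f, c f, d f])
  obtain ⟨hN, hP⟩ := hb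
  refine ⟨?_, ?_, ?_, ?_⟩
  · intro X hX Y₁ a Y₂ b Y₃ c Y₄ d
    exact word X Y₁ Y₂ Y₃ Y₄ gN gN gN gN (fun f => (hN X hX f).2) (fun f => (hN Y₁ a f).1) (fun f => (hN Y₂ b f).1)
      (fun f => (hN Y₃ c f).1) (fun f => (hN Y₄ d f).1) (by linarith) 4 (by norm_num)
  · intro X hX Y₁ a Y₂ b Y₃ c W d
    exact word X Y₁ Y₂ Y₃ W gN gN gN gP (fun f => (hN X hX f).2) (fun f => (hN Y₁ a f).1) (fun f => (hN Y₂ b f).1)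
      (fun f => (hN Y₃ c f).1) (fun f => (hP W d f).1) (by linarith) 3 (by norm_num)
  · intro X hX Y₁ a Y₂ b Y₃ c Y₄ d
    exact word X Y₁ Y₂ Y₃ Y₄ gN gN gN gN (fun f => (hP X hX f).2) (fun f => (hN Y₁ a f).1) (fun f => (hN Y₂ b f).1)
      (fun f => (hN Y₃ c f).1) (fun f => (hN Y₄ d f).1) (by linarith) 5 (by norm_num)
  · intro X hX Y₁ a Y₂ b Y₃ c W d
    exact word X Y₁ Y₂ Y₃ W gN gN gN gP (fun f => (hP X hX f).2) (fun f => (hN Y₁ a f).1) (fun f => (hN Y₂ b f).1)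
      (fun f => (hN Y₃ c f).1) (fun f => (hP W d f).1) (by linarith) 4 (by norm_num)

/-- `LiftFree S`: no upper cell is live in degree 1, i.e. `H¹(P, W) = 0` for every realisation of every upper cell `W`; then
`H¹(P, 𝓟) = 0` and the hypothesis (LIFT) of LAW (i) — the regular section `s ∈ H⁰(E)` lifts to `s̃ ∈ H⁰(𝓝)` — is automatic (p3).
On `c8` ∕ LINE-12 it FAILS (16 equator upper cells `P[(h∕2)ℓ_ζ | hI | hI | hI]`, index range `[0,1]`: `equatorCell_live`), so there
(LIFT) is a genuine hypothesis on the design — the census's own convention `s = (s_Y)_Y` (PAD4-FIRSTORDER §0). -/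
def LiftFree (S : Support) : Prop := ∀ W ∈ S.upper, ¬ Cell.Live 1 W

instance (S : Support) : Decidable S.LiftFree := by unfold LiftFree; infer_instance

/-- positive upper gap ⇒ lift-free (all upper cells positive definite, index range `{0}`). -/
theorem liftFree_of_gap (S : Support) (gN gP t : ℤ) (hb : S.GapBound gN gP t) (h : 0 < gP) : S.LiftFree := by
  intro W hW hlive
  have k : ∀ f, (W f).idxHi = 0 := fun f => ((W f).idx_of_gap_pos (by linarith [(hb.2 W hW f).1])).2
  unfold Cell.Live Cell.idxHi at hlive
  rw [k 0, k 1, k 2, k 3] at hlive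
  omega

end Support

/-- the equator upper cell `P[4ℓ₁ | 8I | 8I | 8I]` of `c8` is live in degrees 0 and 1 (index range `[0,1]`): `c8` is NOT lift-free. -/
theorem equatorCell_live : Cell.Live 0 (cellOf (4, 4, 0) e8 e8 e8) ∧ Cell.Live 1 (cellOf (4, 4, 0) e8 e8 e8) ∧
    ¬ Cell.Live 2 (cellOf (4, 4, 0) e8 e8 e8) := by decide

/-- the ceiling fragment: `gap ≥ 4` below (`(6,2,0)`), `≥ 6` above, `top ≤ 8` — kernel check. -/
theorem c8Fragment_gapBound : c8Fragment.GapBound 4 6 8 := by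
  unfold Support.GapBound; constructor <;> decide

/-- ALL-BLOCK certificate of the fragment: block 2 by the equator law (§4), blocks 3, 4 by the gap law (`8 < 12`, `8 < 14`; `8 < 16`, `8 < 18`). -/
theorem c8Fragment_noLiveLeak : c8Fragment.NoLiveLeak :=
  ⟨c8Fragment_noLiveLeak₂,
   c8Fragment.noLiveLeak₃_of_gap 4 6 8 c8Fragment_gapBound (by norm_num) (by norm_num),
   c8Fragment.noLiveLeak₄_of_gap 4 6 8 c8Fragment_gapBound (by norm_num) (by norm_num)⟩

theorem c8Fragment_liftFree : c8Fragment.LiftFree :=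
  c8Fragment.liftFree_of_gap 4 6 8 c8Fragment_gapBound (by norm_num)

/-- The display support of record `supp-a1a8405da9ba0240` (hsemireg-check-static-1 `cells/b41/…cells.json`, sha16 28d91111054e7745;
h = 14; 17 lower + 48 upper cells, all of Hermitian rank 8; the rank ≥ 8 display programme), typed literally. -/
def suppA1a8 : Support where
  lower := [
    cellOf (12, -2, 0) (12, -2, 0) (12, -2, 0) (13, 0, 1),
    cellOf (12, -2, 0) (12, -2, 0) (13, 0, 1) (12, -2, 0),
    cellOf (12, -2, 0) (13, 0, 1) (12, -2, 0) (12, -2, 0),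
    cellOf (12, 0, -2) (12, 0, -2) (12, 0, -2) (13, -1, 0),
    cellOf (12, 0, -2) (12, 0, -2) (13, -1, 0) (12, 0, -2),
    cellOf (12, 0, -2) (13, -1, 0) (12, 0, -2) (12, 0, -2),
    cellOf (12, 0, 2) (12, 0, 2) (12, 0, 2) (13, 1, 0),
    cellOf (12, 0, 2) (12, 0, 2) (13, 1, 0) (12, 0, 2),
    cellOf (12, 0, 2) (13, 1, 0) (12, 0, 2) (12, 0, 2),
    cellOf (12, 2, 0) (12, 2, 0) (12, 2, 0) (13, 0, -1),
    cellOf (12, 2, 0) (12, 2, 0) (13, 0, -1) (12, 2, 0),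
    cellOf (12, 2, 0) (13, 0, -1) (12, 2, 0) (12, 2, 0),
    cellOf (13, -1, 0) (12, 0, -2) (12, 0, -2) (12, 0, -2),
    cellOf (13, 0, -1) (12, 2, 0) (12, 2, 0) (12, 2, 0),
    cellOf (13, 0, 1) (12, -2, 0) (12, -2, 0) (12, -2, 0),
    cellOf (13, 1, 0) (12, 0, 2) (12, 0, 2) (12, 0, 2),
    cellOf (14, 0, 0) (14, 0, 0) (14, 0, 0) (14, 0, 0)]
  upper := [
    cellOf (12, -2, 0) (12, -2, 0) (12, -2, 0) (12, 0, 2),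
    cellOf (12, -2, 0) (12, -2, 0) (12, -2, 0) (13, 0, -1),
    cellOf (12, -2, 0) (12, -2, 0) (12, -2, 0) (14, 0, 0),
    cellOf (12, -2, 0) (12, -2, 0) (12, 0, 2) (12, -2, 0),
    cellOf (12, -2, 0) (12, -2, 0) (13, 0, -1) (12, -2, 0),
    cellOf (12, -2, 0) (12, -2, 0) (14, 0, 0) (12, -2, 0),
    cellOf (12, -2, 0) (12, 0, -2) (12, 0, -2) (12, 0, -2),
    cellOf (12, -2, 0) (12, 0, 2) (12, -2, 0) (12, -2, 0),
    cellOf (12, -2, 0) (13, 0, -1) (12, -2, 0) (12, -2, 0),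
    cellOf (12, -2, 0) (14, 0, 0) (12, -2, 0) (12, -2, 0),
    cellOf (12, 0, -2) (12, -2, 0) (12, 0, -2) (12, 0, -2),
    cellOf (12, 0, -2) (12, 0, -2) (12, -2, 0) (12, 0, -2),
    cellOf (12, 0, -2) (12, 0, -2) (12, 0, -2) (12, -2, 0),
    cellOf (12, 0, -2) (12, 0, -2) (12, 0, -2) (13, 1, 0),
    cellOf (12, 0, -2) (12, 0, -2) (12, 0, -2) (14, 0, 0),
    cellOf (12, 0, -2) (12, 0, -2) (13, 1, 0) (12, 0, -2),
    cellOf (12, 0, -2) (12, 0, -2) (14, 0, 0) (12, 0, -2),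
    cellOf (12, 0, -2) (12, 2, 0) (12, 2, 0) (12, 2, 0),
    cellOf (12, 0, -2) (13, 1, 0) (12, 0, -2) (12, 0, -2),
    cellOf (12, 0, -2) (14, 0, 0) (12, 0, -2) (12, 0, -2),
    cellOf (12, 0, 2) (12, -2, 0) (12, -2, 0) (12, -2, 0),
    cellOf (12, 0, 2) (12, 0, 2) (12, 0, 2) (12, 2, 0),
    cellOf (12, 0, 2) (12, 0, 2) (12, 0, 2) (13, -1, 0),
    cellOf (12, 0, 2) (12, 0, 2) (12, 0, 2) (14, 0, 0),
    cellOf (12, 0, 2) (12, 0, 2) (12, 2, 0) (12, 0, 2),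
    cellOf (12, 0, 2) (12, 0, 2) (13, -1, 0) (12, 0, 2),
    cellOf (12, 0, 2) (12, 0, 2) (14, 0, 0) (12, 0, 2),
    cellOf (12, 0, 2) (12, 2, 0) (12, 0, 2) (12, 0, 2),
    cellOf (12, 0, 2) (13, -1, 0) (12, 0, 2) (12, 0, 2),
    cellOf (12, 0, 2) (14, 0, 0) (12, 0, 2) (12, 0, 2),
    cellOf (12, 2, 0) (12, 0, -2) (12, 2, 0) (12, 2, 0),
    cellOf (12, 2, 0) (12, 0, 2) (12, 0, 2) (12, 0, 2),
    cellOf (12, 2, 0) (12, 2, 0) (12, 0, -2) (12, 2, 0),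
    cellOf (12, 2, 0) (12, 2, 0) (12, 2, 0) (12, 0, -2),
    cellOf (12, 2, 0) (12, 2, 0) (12, 2, 0) (13, 0, 1),
    cellOf (12, 2, 0) (12, 2, 0) (12, 2, 0) (14, 0, 0),
    cellOf (12, 2, 0) (12, 2, 0) (13, 0, 1) (12, 2, 0),
    cellOf (12, 2, 0) (12, 2, 0) (14, 0, 0) (12, 2, 0),
    cellOf (12, 2, 0) (13, 0, 1) (12, 2, 0) (12, 2, 0),
    cellOf (12, 2, 0) (14, 0, 0) (12, 2, 0) (12, 2, 0),
    cellOf (13, -1, 0) (12, 0, 2) (12, 0, 2) (12, 0, 2),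
    cellOf (13, 0, -1) (12, -2, 0) (12, -2, 0) (12, -2, 0),
    cellOf (13, 0, 1) (12, 2, 0) (12, 2, 0) (12, 2, 0),
    cellOf (13, 1, 0) (12, 0, -2) (12, 0, -2) (12, 0, -2),
    cellOf (14, 0, 0) (12, -2, 0) (12, -2, 0) (12, -2, 0),
    cellOf (14, 0, 0) (12, 0, -2) (12, 0, -2) (12, 0, -2),
    cellOf (14, 0, 0) (12, 0, 2) (12, 0, 2) (12, 0, 2),
    cellOf (14, 0, 0) (12, 2, 0) (12, 2, 0) (12, 2, 0)]
theorem suppA1a8_sizes : suppA1a8.lower.length = 17 ∧ suppA1a8.upper.length = 48 := by decide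

/-- letter bounds of the display support: `gap ≥ 10` on both levels, `top ≤ 14` — kernel check. -/
theorem suppA1a8_gapBound : suppA1a8.GapBound 10 10 14 := by
  unfold Support.GapBound; constructor <;> decide

/-- ALL-BLOCK certificate of a display support OF RECORD, by the gap law alone (`14 < 20`; `14 < 30`; `14 < 40`), no enumeration:
every design supported on `a1a8405d` (any multiplicities, any Pic⁰-labels) is leak-free AND lift-free, hence — by LAW (i), pencil (L2)–(L5) —
(INJ_E)-clean: the census dictionary's no-go is unconditional there mod its classical fields.  (Tool log `leak-supp-a1a8405da9ba0240.log`
agrees: 0 live words.) -/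
theorem suppA1a8_noLiveLeak : suppA1a8.NoLiveLeak :=
  ⟨suppA1a8.noLiveLeak₂_of_gap 10 10 14 suppA1a8_gapBound (by norm_num) (by norm_num),
   suppA1a8.noLiveLeak₃_of_gap 10 10 14 suppA1a8_gapBound (by norm_num) (by norm_num),
   suppA1a8.noLiveLeak₄_of_gap 10 10 14 suppA1a8_gapBound (by norm_num) (by norm_num)⟩

theorem suppA1a8_liftFree : suppA1a8.LiftFree :=
  suppA1a8.liftFree_of_gap 10 10 14 suppA1a8_gapBound (by norm_num)

/-- … whereas the floor-hung toy support leaks in every block-2 family (§4) and is not even block-3 clean: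
`X − Y − Y − Y` with `X = Y = N[O|O|O|4ℓ₁]` is `−2Y`, live in degree 3 — kernel check. -/
theorem toyFloor_leaks₃ : ¬ toyFloor.NoLiveLeak₃ := by decide


end Summit.HodgeConjecture.HodgeConjecture.Cruxes.BlochSeedDiscOne.InjELeakLaw
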